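import Mathlib
import Literature.Analysis.FluidPDE.SelfSimilar
import Literature.Analysis.FluidPDE.AxisymmetricEuler
import Literature.Analysis.FluidPDE.AxisymmetricVorticityTransport
import Literature.Analysis.FluidPDE.AxisymmetricReflection
import Literature.Analysis.FluidPDE.PineauVicolRSS
import Literature.Analysis.FluidPDE.PineauVicolRDSSLeray
import Summits.NavierStokesRegularity.NavierStokesRegularity.Theorems.DssFarFieldSlavingBlowupTypeIDssProfileReversingInfiniteOrderTwist
import Summits.NavierStokesRegularity.NavierStokesRegularity.Theorems.DssFarFieldSlavingBlowupTypeIDssProfileTiltedIsotropyCalculus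
import HarnessLib

/-!
# Non-vacuity witness for the rigid-rotation class theorem (pub-ns-dss theory T27, vacuity note V17)

HONEST FRAMING. This file proves NOTHING about Navier–Stokes. It exhibits, for every rotation rate `α`,
an explicit continuous field satisfying EVERY hypothesis of
`RigidRotation.rdssClass_tiltedRigidRotation_empty` EXCEPT mildness (H5): the class constraints
H0 (`1 < c`), H2 (`(c, R)`-RDSS), H3 (Type-I decay, `M = 1`), H4 (measurable slices), H6 (not a.e. zero),
the rigid-rotation structure (i) for every factor `λ > 0` (axis `e₃`, `P = 1`), and the one-slice
isotropy (ii) under the meridian mirror `g = reflY`, which does not commute with the rotations about `e₃`.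
Hence the class theorem is not vacuously true and not "rigid by hypotheses": its conclusion uses the PDE.
The witness profile `U₀(y) = (1 + ‖y‖)⁻¹ e₁` is NOT axisymmetric (`witnessProfile_not_axisymmetric`) —
so the witness also lies outside the axisymmetric cell E2 — and its slices `t ≠ −1` are in general not
`reflY`-equivariant (`witnessField_slice_not_reflY`): the one-slice form of (ii) is strictly weaker
than the every-slice form (red R-50, 2026-08-22).

The witness is the rotated self-similar field `pvAnsatz α U₀` with the (non-solenoidal, irrelevant)
profile `U₀(y) = (1 + ‖y‖)⁻¹ e₁`.
TYPER NOTE (landing prep): the theory file's two definitions `witnessProfile`, `witnessField` are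
INLINED here (written out in every statement) and the helper lemmas are private with docstrings; the
mathematical content is the theory seat's file sha256[16] e32e599b6c40ebcc (v2, red R-50 folded: witness direction e₁) unchanged.
-/

noncomputable section

set_option linter.dupNamespace false

namespace Summit.NavierStokesRegularity.NavierStokesRegularity.Theorems.RigidRotation

open MeasureTheory Set Function Literature.Analysis.FluidPDE
open Summit.NavierStokesRegularity.NavierStokesRegularity.Theorems
open Summit.NavierStokesRegularity.NavierStokesRegularity.Theorems.ReversingIsotropy
open Summit.NavierStokesRegularity.NavierStokesRegularity.Theorems.TiltedIsotropy

/-! The witness profile is `U₀(y) = (1 + ‖y‖)⁻¹ • e₁` (constant HORIZONTAL direction: NOT axisymmetric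
about `e₃`, yet `reflY`-equivariant since `reflY` fixes `e₁` — red R-50) and the witness field is the rotated self-similar
field `pvAnsatz α (fun y _ => U₀ y)`; both are written out in every statement (the theory file's two
`def`s were inlined by the typer so that this evidence file stays a pure proof file). -/

/-- The witness profile `y ↦ (1 + ‖y‖)⁻¹ • e₁` is continuous. [this file] -/
private theorem continuous_witnessProfile : Continuous (fun y : EuclideanSpace ℝ (Fin 3) => (1 + ‖y‖)⁻¹ • (EuclideanSpace.single 0 (1 : ℝ) : EuclideanSpace ℝ (Fin 3))) := by
  have h1 : Continuous fun y : EuclideanSpace ℝ (Fin 3) => (1 + ‖y‖)⁻¹ :=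
    Continuous.inv₀ (continuous_const.add continuous_norm) fun y => by positivity
  exact h1.smul continuous_const

/-- `‖U₀ y‖ = (1 + ‖y‖)⁻¹`. [this file] -/
private theorem norm_witnessProfile (y : EuclideanSpace ℝ (Fin 3)) :
    ‖(1 + ‖y‖)⁻¹ • (EuclideanSpace.single 0 (1 : ℝ) : EuclideanSpace ℝ (Fin 3))‖ = (1 + ‖y‖)⁻¹ := by
  rw [norm_smul, Real.norm_eq_abs, abs_of_pos (by positivity)]
  simp

/-- The meridian mirror fixes `e₁`. [this file] -/
private theorem reflY_e1 : reflY (EuclideanSpace.single 0 (1 : ℝ)) = EuclideanSpace.single 0 (1 : ℝ) := by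
  ext i
  fin_cases i <;> simp [reflY]

/-- `U₀` is `reflY`-equivariant. [this file] -/
private theorem witnessProfile_reflY (y : EuclideanSpace ℝ (Fin 3)) :
    (1 + ‖reflY y‖)⁻¹ • (EuclideanSpace.single 0 (1 : ℝ) : EuclideanSpace ℝ (Fin 3)) =
      reflY ((1 + ‖y‖)⁻¹ • (EuclideanSpace.single 0 (1 : ℝ) : EuclideanSpace ℝ (Fin 3))) := by
  rw [LinearIsometryEquiv.norm_map, LinearIsometryEquiv.map_smul, reflY_e1]

/-- The witness field's slice at `t = −1` is `U₀`. [this file] -/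
private theorem witnessField_neg_one (α : ℝ) (x : EuclideanSpace ℝ (Fin 3)) :
    (pvAnsatz α (fun y _ => (1 + ‖y‖)⁻¹ • (EuclideanSpace.single 0 (1 : ℝ) : EuclideanSpace ℝ (Fin 3)))) (-1) x = (1 + ‖x‖)⁻¹ • (EuclideanSpace.single 0 (1 : ℝ) : EuclideanSpace ℝ (Fin 3)) := by
  simp [pvAnsatz, rotZ_zero]

/-- `U₀ 0 ≠ 0`. [this file] -/
private theorem witnessProfile_zero_ne :
    (1 + ‖(0 : EuclideanSpace ℝ (Fin 3))‖)⁻¹ • (EuclideanSpace.single 0 (1 : ℝ) : EuclideanSpace ℝ (Fin 3)) ≠ 0 := by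
  intro h
  have := congrArg (fun v : EuclideanSpace ℝ (Fin 3) => v 0) h
  simp at this

/-- `R_θ 0 = 0`. [folklore] -/
private theorem rotZ_zero_vec (θ : ℝ) : rotZ θ (0 : EuclideanSpace ℝ (Fin 3)) = 0 := by
  ext i
  fin_cases i <;> simp

/-- The witness field at the spatial origin: `u(t, 0) = (√(−t))⁻¹ R_{αs} e₁`, `s = −log(−t)`. [this file] -/
theorem witnessField_apply_zero (α t : ℝ) :
    (pvAnsatz α (fun y _ => (1 + ‖y‖)⁻¹ • (EuclideanSpace.single 0 (1 : ℝ) : EuclideanSpace ℝ (Fin 3)))) t 0 =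
      (Real.sqrt (-t))⁻¹ • rotZ (α * -Real.log (-t)) (EuclideanSpace.single 0 (1 : ℝ)) := by
  simp only [pvAnsatz, smul_zero, rotZ_zero_vec, norm_zero, add_zero, inv_one, one_smul]

/-- The witness profile is NOT axisymmetric about `e₃`: it is not equivariant under the half-turn
`R_π` (its direction `e₁` is turned into `−e₁`). So the non-vacuity witness lies OUTSIDE the
axisymmetric cell (red R-50). [this file] -/
theorem witnessProfile_not_axisymmetric :
    ¬ ∀ (θ : ℝ) (y : EuclideanSpace ℝ (Fin 3)),
      (1 + ‖rotZ θ y‖)⁻¹ • (EuclideanSpace.single 0 (1 : ℝ) : EuclideanSpace ℝ (Fin 3)) =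
        rotZ θ ((1 + ‖y‖)⁻¹ • (EuclideanSpace.single 0 (1 : ℝ) : EuclideanSpace ℝ (Fin 3))) := by
  intro h
  have h1 := congrArg (fun v : EuclideanSpace ℝ (Fin 3) => v 0) (h Real.pi 0)
  have h2 : (1 : ℝ) = -1 := by
    simpa [rotZ_zero_vec, Real.cos_pi, Real.sin_pi] using h1
  norm_num at h2

/-- The slices `t ≠ −1` of the witness field are in general NOT `reflY`-equivariant: for `α ≠ 0`, at
the time `t = −exp(−π/(2α))` (phase `αs = π/2`) the field at the origin points along `e₂`, which
`reflY` reverses. So the ONE-slice isotropy (ii) of the class theorem is strictly weaker than an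
every-slice isotropy, and the witness separates the two (red R-50 (b)). [this file] -/
theorem witnessField_slice_not_reflY {α : ℝ} (hα : α ≠ 0) :
    ∃ t < 0, ¬ ∀ x, (pvAnsatz α (fun y _ => (1 + ‖y‖)⁻¹ • (EuclideanSpace.single 0 (1 : ℝ) : EuclideanSpace ℝ (Fin 3)))) t (reflY x) = reflY ((pvAnsatz α (fun y _ => (1 + ‖y‖)⁻¹ • (EuclideanSpace.single 0 (1 : ℝ) : EuclideanSpace ℝ (Fin 3)))) t x) := by
  set q : ℝ := -(Real.pi / (2 * α)) with hq
  refine ⟨-Real.exp q, by linarith [Real.exp_pos q], fun h => ?_⟩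
  have hs : 0 < (Real.sqrt (Real.exp q))⁻¹ := inv_pos.mpr (Real.sqrt_pos.mpr (Real.exp_pos q))
  have hang : α * -Real.log (-(-Real.exp q)) = Real.pi / 2 := by
    rw [neg_neg, Real.log_exp, hq]
    field_simp
  have h0 := h 0
  rw [map_zero, witnessField_apply_zero, hang, neg_neg] at h0
  have h1 := congrArg (fun v : EuclideanSpace ℝ (Fin 3) => v 1) h0
  simp [reflY, Real.sin_pi_div_two, Real.cos_pi_div_two] at h1
  linarith

/-- `rotZ θ` is continuous. [folklore] -/
private theorem continuous_rotZ' (θ : ℝ) : Continuous (rotZ θ) := (rotZLIE θ).continuous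

/-- Every slice of the witness field is continuous. [this file] -/
private theorem continuous_witnessField (α : ℝ) (t : ℝ) : Continuous ((pvAnsatz α (fun y _ => (1 + ‖y‖)⁻¹ • (EuclideanSpace.single 0 (1 : ℝ) : EuclideanSpace ℝ (Fin 3)))) t) := by
  unfold pvAnsatz
  have h1 : Continuous fun x : EuclideanSpace ℝ (Fin 3) => (Real.sqrt (-t))⁻¹ • x :=
    continuous_id.const_smul ((Real.sqrt (-t))⁻¹)
  have h2 : Continuous fun x : EuclideanSpace ℝ (Fin 3) =>
      rotZ (α * -Real.log (-t)) ((fun y : EuclideanSpace ℝ (Fin 3) => (1 + ‖y‖)⁻¹ • (EuclideanSpace.single 0 (1 : ℝ) : EuclideanSpace ℝ (Fin 3))) (rotZ (-(α * -Real.log (-t))) ((Real.sqrt (-t))⁻¹ • x))) :=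
    (continuous_rotZ' _).comp (continuous_witnessProfile.comp ((continuous_rotZ' _).comp h1))
  exact h2.const_smul ((Real.sqrt (-t))⁻¹)

/-- The witness field has Type-I space–time decay with constant `1`. [this file] -/
private theorem hasTypeIDecay_witnessField (α : ℝ) : HasTypeIDecay 1 (pvAnsatz α (fun y _ => (1 + ‖y‖)⁻¹ • (EuclideanSpace.single 0 (1 : ℝ) : EuclideanSpace ℝ (Fin 3)))) := by
  intro t ht x
  have hs : 0 < Real.sqrt (-t) := Real.sqrt_pos.mpr (by linarith)
  unfold pvAnsatz
  rw [norm_smul, norm_rotZ, norm_witnessProfile, norm_rotZ, norm_smul, Real.norm_eq_abs,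
    abs_of_pos (inv_pos.mpr hs)]
  apply le_of_eq
  have hx : 0 ≤ ‖x‖ := norm_nonneg _
  field_simp
  ring

/-- The witness field is `(c, R(−2α log c))`-RDSS about `e₃` for every `c > 0`. [this file] -/
private theorem isRotatedDSS_witnessField (α : ℝ) {c : ℝ} (hc : 0 < c) :
    IsRotatedDSS c (rotZLIE (-(α * (2 * Real.log c)))) (pvAnsatz α (fun y _ => (1 + ‖y‖)⁻¹ • (EuclideanSpace.single 0 (1 : ℝ) : EuclideanSpace ℝ (Fin 3)))) :=
  PineauVicol2026.isRotatedDSS_pvAnsatz hc fun _ _ => rfl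

/-- Conjugating by the identity isometry does nothing. [folklore] -/
private theorem refl_conj (S : EuclideanSpace ℝ (Fin 3) ≃ₗᵢ[ℝ] EuclideanSpace ℝ (Fin 3)) :
    ((LinearIsometryEquiv.refl ℝ (EuclideanSpace ℝ (Fin 3))).symm.trans S).trans
      (LinearIsometryEquiv.refl ℝ (EuclideanSpace ℝ (Fin 3))) = S := by
  ext x
  rfl

/-- The meridian mirror does not commute with the rotations about `e₃` (in the `P = 1` form of the
class theorem's hypothesis `hg`). [this file] -/
theorem reflY_noncommuting :
    ∃ (φ : ℝ) (y : EuclideanSpace ℝ (Fin 3)),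
      reflY ((((LinearIsometryEquiv.refl ℝ _).symm.trans (rotZLIE φ)).trans (LinearIsometryEquiv.refl ℝ _)) y) ≠
        (((LinearIsometryEquiv.refl ℝ _).symm.trans (rotZLIE φ)).trans (LinearIsometryEquiv.refl ℝ _)) (reflY y) := by
  obtain ⟨φ, y, h⟩ := exists_not_commute_of_reversing reversesRotZ_reflY
  refine ⟨φ, y, ?_⟩
  rw [refl_conj]
  simpa using h

/-- **Non-vacuity of `rdssClass_tiltedRigidRotation_empty` (V17).** For every rate `α`, all hypotheses
of the class theorem except mildness — `1 < c`, measurable slices, `(c, R)`-RDSS, Type-I decay with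
`M = 1`, the rigid-rotation structure (i) for every factor (axis `e₃`, `P = 1`), the one-slice mirror
isotropy (ii) with `g = reflY` (non-commuting: `reflY_noncommuting`), and non-triviality — are satisfied
by the explicit continuous field `pvAnsatz α (fun y _ => (1 + ‖y‖)⁻¹ • e₃)` (written out). So the theorem's content is the PDE. [this file] -/
theorem rdssClass_tiltedRigidRotation_hypotheses_satisfiable (α : ℝ) :
    ∃ (c : ℝ) (R : EuclideanSpace ℝ (Fin 3) ≃ₗᵢ[ℝ] EuclideanSpace ℝ (Fin 3))
      (u : ℝ → EuclideanSpace ℝ (Fin 3) → EuclideanSpace ℝ (Fin 3)),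
      1 < c ∧ (∀ t < 0, AEStronglyMeasurable (u t) volume) ∧
      IsRotatedDSS c R u ∧ HasTypeIDecay 1 u ∧
      (∀ lam : ℝ, 0 < lam → ∀ t < 0,
        (fun x => lam • (((LinearIsometryEquiv.refl ℝ _).symm.trans
            (rotZLIE (-(α * (2 * Real.log lam))))).trans (LinearIsometryEquiv.refl ℝ _)).symm
          (u (lam ^ 2 * t) (lam • (((LinearIsometryEquiv.refl ℝ _).symm.trans
            (rotZLIE (-(α * (2 * Real.log lam))))).trans (LinearIsometryEquiv.refl ℝ _)) x)))
          =ᵐ[volume] u t) ∧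
      ((fun x => u (-1) (reflY x)) =ᵐ[volume] fun x => reflY (u (-1) x)) ∧
      ¬ (∀ t < 0, u t =ᵐ[volume] 0) := by
  refine ⟨2, rotZLIE (-(α * (2 * Real.log 2))), (pvAnsatz α (fun y _ => (1 + ‖y‖)⁻¹ • (EuclideanSpace.single 0 (1 : ℝ) : EuclideanSpace ℝ (Fin 3)))), by norm_num,
    fun t _ => (continuous_witnessField α t).aestronglyMeasurable,
    isRotatedDSS_witnessField α (by norm_num), hasTypeIDecay_witnessField α, ?_, ?_, ?_⟩
  · intro lam hlam t _
    rw [refl_conj]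
    exact Filter.Eventually.of_forall fun x => isRotatedDSS_witnessField α hlam t x
  · refine Filter.Eventually.of_forall fun x => ?_
    simp only [witnessField_neg_one]
    exact witnessProfile_reflY x
  · intro h
    have h1 : (pvAnsatz α (fun y _ => (1 + ‖y‖)⁻¹ • (EuclideanSpace.single 0 (1 : ℝ) : EuclideanSpace ℝ (Fin 3)))) (-1) =ᵐ[volume] (0 : EuclideanSpace ℝ (Fin 3) → EuclideanSpace ℝ (Fin 3)) :=
      h (-1) (by norm_num)
    have h2 : (pvAnsatz α (fun y _ => (1 + ‖y‖)⁻¹ • (EuclideanSpace.single 0 (1 : ℝ) : EuclideanSpace ℝ (Fin 3)))) (-1) = 0 :=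
      (Continuous.ae_eq_iff_eq volume (continuous_witnessField α (-1)) continuous_const).mp h1
    have h3 := congrFun h2 0
    rw [witnessField_neg_one] at h3
    exact witnessProfile_zero_ne h3

end Summit.NavierStokesRegularity.NavierStokesRegularity.Theorems.RigidRotation

end
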